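import Summits.AtomisticToContinuum.Statement

/-!
# AtomisticToContinuum — route RefuteCrystalPeriodicMin, assembly (rank 1)

The negative route: if the infimum over periodic configurations of `ℝ³` of the Lennard-Jones
energy per particle is not attained, then `HasPeriodicGroundStateEnergy lennardJones 3` fails
(it asserts a periodic least element), hence `Crystallization` fails, hence the summit
`AtomisticToContinuum` fails. Pure unfolding.
-/

namespace Literature.StatMech

open Filter Topology

/-- Settles stmt-AtomisticToContinuum-0669 (assembly of route RefuteCrystalPeriodicMin):
non-attainment of the periodic Lennard-Jones minimum in `ℝ³` refutes the summit, by unfolding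
`AtomisticToContinuum → Crystallization → HasPeriodicGroundStateEnergy lennardJones 3 → ∃ P,
IsLeast …`. [folklore] -/
theorem not_atomisticToContinuum_of_not_periodic_min_attained :
    (¬ ∃ P : Literature.MathematicalPhysics.StatisticalMechanics.PeriodicConfiguration 3,
        IsLeast (Set.range fun Q : Literature.MathematicalPhysics.StatisticalMechanics.PeriodicConfiguration 3 =>
          Q.energyPerParticle Literature.MathematicalPhysics.StatisticalMechanics.lennardJones)
          (P.energyPerParticle Literature.MathematicalPhysics.StatisticalMechanics.lennardJones)) → ¬ AtomisticToContinuum := by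
  intro h hA
  apply h
  obtain ⟨P, hP, -⟩ := (AtomisticToContinuum_iff.mp hA).2.2.1.1
  exact ⟨P, hP⟩

end Literature.StatMech
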